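import Summits.HubbardSuperconductivity.HubbardSuperconductivity.Theses.ThermalWedge
import Summits.HubbardSuperconductivity.HubbardSuperconductivity.Theorems.ThermalWedgeTwSeededEnsembleEquivalenceRAnomalousRemainderSmall
import Summits.HubbardSuperconductivity.HubbardSuperconductivity.Theorems.ThermalWedgeTwSeededEnsembleEquivalenceRFreeAnomalousSignCalibration
import Summits.HubbardSuperconductivity.HubbardSuperconductivity.Theorems.ThermalWedgeTwSeededEnsembleEquivalenceROfCondensationDeepUniq

/-!
# Skeleton v11 — crux `TwSeededEnsembleEquivalenceR` (stmt-HubbardSuperconductivity-15581),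
# line `cold-floor-collapse` (slug `Sketch`), lead continuation c11: the physics stub in REMAINDER FORM —
# an `O(a)` one-sided comparison of ONE finite-volume truncated anomalous two-point function with its free value

`TwSeededEnsembleEquivalenceR_of` concludes the crux BY NAME from the route item `TwSourcedCondensation`
(stmt-HubbardSuperconductivity-1697, hypothesis `hC` of the deciding theorem `closes`) and the ONE registered stub below.

History. v7 (leads c2–c9): two physics stubs DEEP-DIFF / DEEP-UNIQ′. v8–v8.5 (lead c10): block two-phase pinning, DEEP-DIFF
eliminated, all 14 finite-dimensional stubs LANDED. Pool seat 0: NoSplit by Ky Fan minimax from plain concavity (p136012/p136124),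
concavity / chord / tangent reductions (p145797, p148057, p148907). v9 (c11): FV-DEEP-CONC. v10 (c11): WARD NORMAL FORM — transverse
Ward identity `χ⊥ = m/h` (Literature `TransverseWardIdentity`, p150124/p152011), `d²/ds² p̃_L(√s) ∝ χ∥ − χ⊥ = (4β/L²)·A_L`,
`A_L := Re(Δ_d,Δ_d)_Duh − (Re⟨Δ_d⟩)²`, so the stub became DEEP-SIGN `A_L(U) ≤ 0` (…RWardReduction p151024/p152446; U = 0 calibration
…RFreeAnomalousSignCalibration p152472). Pool seat 0 (s87) then made the free SIGNAL quantitative — FREE ANOMALOUS MARGIN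
`A_L(0) ≤ −c·L²/β` uniformly on the deep range (…RFreeAnomalousFormula p156058, …RFreeAnomalousMargin p156443) — and landed
`fam_fvDeepAnomalousSign_of_remainder` / `twR_of_condensation_of_anomalousRemainder` (…RFreeAnomalousReduction p156645).

v11 (this file) registers the physics in that REMAINDER form, the natural output of a sourced weak-coupling expansion in which
every order carries `U·log(1/h) ≤ a/4`:

* `stub_anomalousRemainder` (REM₀): for every window `[μ₁,μ₂] ⊂ (−4,0)` there are `a₀ > 0`, `C ≥ 0` such that for all `a ∈ (0,a₀]` there are
  `K', U₀ > 0` with: for `U ∈ (0,U₀]`, `g ∈ [K'U, 1/10]`, interior `μ`, EVENTUALLY IN `L`, at `β = e^{a/U}` and every deep source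
  `h ∈ (e^{−a/(4U)}, 13g+1)`:  `A_L(U; β, μ, h) − A_L(0; β, μ, h) ≤ C · a · L² / e^{a/U}`
  (the interacting truncated anomalous pair correlator exceeds the free one by at most `O(a)·L²/β`; `C` independent of `a`).

REM₀ ⟹ DEEP-SIGN (`rem_fvDeepAnomalousSign_of_smallRemainder`, seat 0's `fam_fvDeepAnomalousSign_of_remainder` with `a₁ := min a₀ (c/(C+1))`, using the free margin) ⟹ FV-DEEP-CONC (Ward dictionary) ⟹ NoSplit (Ky Fan + FLOOR
from `hC`) ⟹ cold slice ⟹ R. Seat 0's REM asks the bound for every `a ∈ (0,1]`; REM₀ asks it only for `a ≤ a₀` (inside the radius of the expansion), REM ⟹ REM₀. Calibration: at `U = 0` REM₀ is `0 ≤ C·a·L²/β` (trivial); DEEP-SIGN at `U = 0` is `cal_freeDeepAnomalousSign`;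
first order in `U` is signed (`−(U/2)(∂_h n₀)²` + Hartree shift). What is NOT in print: REM₀ itself — all-order control at `β = e^{a/U}` of
ONE truncated two-point function at sources `≥ e^{−a/(4U)} ≫ T` with bounds relative to `L²/β` (2D Fermi-surface sectors between scales
`1` and `h`, BGM2006/2003 class; nodal Dirac fermions below `h`, GM2010 class). OPEN (`sorry` only in `stub_*`): ONLY `stub_anomalousRemainder` (REM₀)
— plus the route item 1697 (`hC`). Alternative LANDED closing interfaces (weaker hypotheses, same class): DEEP-SIGN
(`twR_of_condensation_of_fvDeepAnomalousSign`, binder-free `twR_of_condensation_of_deepAnomalousSign`), DEEP-HG `χ∥ ≤ χ⊥`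
(`twR_of_condensation_of_fvDeepHiggsGoldstone`), FV-DEEP-CONC (`twR_of_condensation_of_fvDeepConcavity`), deep chords
(`twR_of_condensation_of_fvDeepChordMonotone`), DEEP-UNIQ′ (`stub_twR_of_condensation_of_deepUniq`); hC-FREE whole-box forms
`twR_of_fvAnomalousSign` / `twR_of_fvHiggsGoldstone` / `twR_of_fvConcavity` / `twR_of_fvChordMonotone` / `twR_of_fvTangentLeChord`.
-/

set_option linter.dupNamespace false

namespace Summit.HubbardSuperconductivity.HubbardSuperconductivity.Theorems.TwSeededEnsembleEquivalenceR.ColdFloorLine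

open Matrix Filter Topology Finset Literature.MathematicalPhysics.QuantumLattice
open Summit.HubbardSuperconductivity.HubbardSuperconductivity.Theses.ThermalWedge
open Summit.HubbardSuperconductivity.HubbardSuperconductivity.Theorems
open scoped ComplexOrder Matrix.Norms.L2Operator

noncomputable section

/-- **REM₀ (PHYSICS stub, registered v11): the `O(a)` anomalous remainder for small exponents.** For every compact window
`⊂ (−4,0)` there are `a₀ > 0` and `C ≥ 0` such that for all `a ∈ (0,a₀]` there are `K', U₀ > 0` with: for `U ∈ (0,U₀]`, `g ∈ [K'U, 1/10]`, `μ ∈ (μ₁,μ₂)`, eventually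
in `L`, at `β = e^{a/U}` and every `h ∈ (e^{−a/(4U)}, 13g+1)`, the truncated anomalous Duhamel d-wave pair correlator
`A_L = Re(Δ_d,Δ_d)_Duh − (Re⟨Δ_d⟩)²` of `dWaveSourceTorus L U μ h` exceeds its FREE value (`dWaveSourceTorus L 0 μ h`) by at most
`C·a·L²/e^{a/U}` (one-sided, relative to the natural size `L²/β` of `A_L`; `C` independent of `a`). With the free anomalous margin
`A_L(0) ≤ −c·L²/β` this gives DEEP-SIGN, hence the crux. [not in print] -/
theorem stub_anomalousRemainder :
    ∀ (μ₁ μ₂ : ℝ), -4 < μ₁ → μ₁ < μ₂ → μ₂ < 0 → ∃ a₀ C : ℝ, 0 < a₀ ∧ 0 ≤ C ∧ ∀ a ∈ Set.Ioc (0 : ℝ) a₀, ∃ K' U₀ : ℝ, 0 < K'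
      ∧ 0 < U₀ ∧ ∀ U ∈ Set.Ioc (0 : ℝ) U₀, ∀ g ∈ Set.Icc (K' * U) (1 / 10), ∀ μ ∈ Set.Ioo μ₁ μ₂, ∃ L₀ : ℕ, ∀ (L : ℕ) [NeZero
      L], L₀ ≤ L → ∀ h ∈ Set.Ioo (Real.exp (-(a / (4 * U)))) (13 * g + 1), ((Matrix.duhamel (Real.exp (a / U))
      (Literature.MathematicalPhysics.QuantumLattice.dWaveSourceTorus L U μ h)
      (Literature.MathematicalPhysics.QuantumLattice.pairField Literature.MathematicalPhysics.QuantumLattice.dWaveFormFactor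
      L) (Literature.MathematicalPhysics.QuantumLattice.pairField
      Literature.MathematicalPhysics.QuantumLattice.dWaveFormFactor L)).re - (Matrix.gibbsState (Real.exp (a / U))
      (Literature.MathematicalPhysics.QuantumLattice.dWaveSourceTorus L U μ h)
      (Literature.MathematicalPhysics.QuantumLattice.pairField Literature.MathematicalPhysics.QuantumLattice.dWaveFormFactor
      L)).re ^ 2) - ((Matrix.duhamel (Real.exp (a / U)) (Literature.MathematicalPhysics.QuantumLattice.dWaveSourceTorus L 0
      μ h) (Literature.MathematicalPhysics.QuantumLattice.pairField
      Literature.MathematicalPhysics.QuantumLattice.dWaveFormFactor L)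
      (Literature.MathematicalPhysics.QuantumLattice.pairField Literature.MathematicalPhysics.QuantumLattice.dWaveFormFactor
      L)).re - (Matrix.gibbsState (Real.exp (a / U)) (Literature.MathematicalPhysics.QuantumLattice.dWaveSourceTorus L 0 μ
      h) (Literature.MathematicalPhysics.QuantumLattice.pairField
      Literature.MathematicalPhysics.QuantumLattice.dWaveFormFactor L)).re ^ 2) ≤ C * a * (L : ℝ) ^ 2 / Real.exp (a / U) := by
  sorry

/-- **The line's composition (v11): the crux by name, from the route item `TwSourcedCondensation` (stmt-1697, hypothesis `hC` of
`closes`) modulo the ONE registered physics stub REM₀ `stub_anomalousRemainder`**, via the landed reduction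
`twR_of_condensation_of_smallAnomalousRemainder` (…RAnomalousRemainderSmall = seat 0's …RFreeAnomalousReduction p156645 with `a ≤ a₀`: free anomalous margin p156443 ∘ Ward reduction
`twR_of_condensation_of_fvDeepAnomalousSign` p151024 ∘ …RConcReduction p145797 ∘ cold slice ∘ S7e packaging ∘ {S7a edge sweep, NoSplit from FLOOR
`stub_optimiserFloor hC` + deep concavity by the Ky Fan minimax glue, S7d two-phase core}). [folklore composition] -/
theorem TwSeededEnsembleEquivalenceR_of (hC : TwSourcedCondensation) : TwSeededEnsembleEquivalenceR :=
  twR_of_condensation_of_smallAnomalousRemainder hC stub_anomalousRemainder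

end

end Summit.HubbardSuperconductivity.HubbardSuperconductivity.Theorems.TwSeededEnsembleEquivalenceR.ColdFloorLine
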